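import Literature.NumberTheory.Sieve.IwaniecBilinearSieveRegime
import HarnessLib

/-!
# Iwaniec's bilinear linear sieve, IX: preparations for the assembly (counting, supports, Buchstab)

Topic `Literature/NumberTheory/Sieve`; ninth support file for the proof of
`Literature.NumberTheory.Sieve.Iwaniec1978.lemma2_bilinearSieve` (H. Iwaniec, *A new form of the error
term in the linear sieve*, Acta Arith. 37 (1980), 307–320, Theorem 1 [IwaniecActaArith1980b]).  Contents:

* the strengthened crude-regime inequality `Core.crude_key3` (`1 + V⁻² + V⁻³ ≪ err`) and the trivial
  main-term bounds it feeds (`Core.crude_regime_bounds3`);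
* the count of bilinear forms: `#𝒰 ≤ Lone ε` uniformly in `D` (`Core.card_Univ_le`) and
  `2 Lone ε + 2 ≤ exp(8 ε⁻³)` (`two_Lone_add_two_le`) — p. 308, "less than `exp(8 ε⁻³)` forms";
* the support of the lower-sieve rows: `a⁻_{m,l} b_{n,l} ≠ 0` forces all primes of `mn` below the box cut
  `D_{j₀+1}` (`Core.primeFactors_lt_of_row_ne_zero`), so that `[mn ∣ P(z)]` is independent of `z ≥ D_{j₀+1}`;
* Buchstab's inequality for finite integer sequences,
  `S(ℬ, Δ) ≤ S(ℬ, z) + ∑_{Δ ≤ p < z} S(ℬ_p, y₁)` (`y₁ ≤ Δ ≤ z`) (`card_sifted_buchstab`), used to extend the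
  lower bound from `z ≤ D_{j₀+1}` to `z ≤ (MN)^{1/2}` (p. 308: "by Buchstab's identity");
* the top box `D_{j*} ≤ D^{1/2} < D_{j*+1}` (`Core.jstar`, `Core.grid_jstar_le`, `Core.lt_grid_jstar_succ`).

Everything is PROVED; no facts.

## References

* H. Iwaniec, *A new form of the error term in the linear sieve*, Acta Arith. 37 (1980), 307–320, p. 308
  and §5. [IwaniecActaArith1980b]
-/

open Finset Real Filter
open scoped ArithmeticFunction.Moebius

noncomputable section

namespace Literature.NumberTheory.Sieve

namespace Iwaniec1980b

/-! ### The splitting of Lemma 1 is a partition (unconditionally) -/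

section Split

variable {D ε η : ℝ} {Mb : ℝ}

/-- `k_M + k_N = k` for the splitting of Lemma 1 (no hypothesis needed). [cite: IwaniecActaArith1980b, Lemma 1 p. 312] -/
theorem splitK_union (k : Multiset ℕ) :
    (splitK (D := D) (ε := ε) (η := η) Mb k).1 + (splitK (D := D) (ε := ε) (η := η) Mb k).2 = k := by
  induction hn : Multiset.card k using Nat.strong_induction_on generalizing k with
  | _ n ih =>
    by_cases hk : k = 0
    · subst hk; rw [splitK_zero]; simp
    have hjk : mmin k ∈ k := mmin_mem hk
    have hlt : Multiset.card (k.erase (mmin k)) < n := by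
      rw [← hn, Multiset.card_erase_of_mem hjk]
      exact Nat.pred_lt (by rw [Ne, Multiset.card_eq_zero]; exact hk)
    have ih' := ih _ hlt (k.erase (mmin k)) rfl
    rw [splitK_of_ne_zero hk]
    split_ifs
    · dsimp only; rw [Multiset.cons_add, ih', Multiset.cons_erase hjk]
    · dsimp only; rw [Multiset.add_cons, ih', Multiset.cons_erase hjk]

end Split

namespace Core

section Support

variable {D ε : ℝ} (hD : 1 < D) (hε : 0 < ε)
include hD hε

/-- **Support of the lower-sieve rows**: if `a⁻_{m,l} · b_{n,l} ≠ 0` then every prime factor of `mn` is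
`< D_{j₀+1}` (the sign `λ_k` vanishes unless all boxes of `k` are `≤ j₀`; the small-composite part divides
`P(u)`, `u = D_0 ≤ D_{j₀+1}`). Hence `[mn ∣ P(z)] = [mn ∣ P(D_{j₀+1})]` for `z ≥ D_{j₀+1}`. [folklore] -/
theorem primeFactors_lt_of_row_ne_zero (j₀ : ℕ) (Mb : ℝ) {l m n : ℕ}
    (h : cA hD hε 0 j₀ Mb l m * cB hD hε Mb l n ≠ 0) :
    ∀ p ∈ (m * n).primeFactors, (p : ℝ) < grid D ε (eta ε) (j₀ + 1) := by
  have hη := eta_pos hε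
  have hA : cA hD hε 0 j₀ Mb l m ≠ 0 := left_ne_zero_of_mul h
  have hB : cB hD hε Mb l n ≠ 0 := right_ne_zero_of_mul h
  set U := Univ hD hε with hU
  set Ps := primesProdBelow (uu D ε) with hPs
  set k := patOf U l with hk
  -- unfold the `m`-coefficient
  have hA' : l < U.card ∧ Lamk (D := D) (ε := ε) 0 j₀ k ≠ 0 ∧
      pat hD hε hη (m / Nat.gcd m Ps) = (splitK (D := D) (ε := ε) (η := eta ε) Mb k).1 := by
    unfold cA coefA at hA
    split_ifs at hA with hl
    · refine ⟨hl, ?_, ?_⟩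
      · intro h0; apply hA; unfold aCoef; rw [← hk, h0]; simp
      · by_contra h0; apply hA; unfold aCoef; rw [← hk, if_neg h0]; simp
    · exact absurd rfl hA
  obtain ⟨hl, hlam, hpatm⟩ := hA'
  have hB' : Nat.gcd n Ps = 1 ∧ pat hD hε hη n = (splitK (D := D) (ε := ε) (η := eta ε) Mb k).2 := by
    unfold cB coefB bCoef at hB
    rw [if_pos hl, ← hk] at hB
    by_contra h0; exact hB (if_neg h0)
  -- the sign forces all boxes `≤ j₀`
  have hcut : ∀ j ∈ k, j ≤ j₀ := by
    by_contra h0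
    apply hlam
    unfold Lamk
    rw [if_neg (fun hc => h0 (hc.2 (by norm_num))), mul_zero]
  have hsplit := splitK_union (D := D) (ε := ε) (η := eta ε) (Mb := Mb) k
  have hM_le : ∀ j ∈ (splitK (D := D) (ε := ε) (η := eta ε) Mb k).1, j ≤ j₀ := fun j hj =>
    hcut j (by rw [← hsplit]; exact Multiset.mem_add.mpr (Or.inl hj))
  have hN_le : ∀ j ∈ (splitK (D := D) (ε := ε) (η := eta ε) Mb k).2, j ≤ j₀ := fun j hj =>
    hcut j (by rw [← hsplit]; exact Multiset.mem_add.mpr (Or.inr hj))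
  have hD1 : (1 : ℝ) ≤ D := hD.le
  have hbox : ∀ p : ℕ, boxIdx hD hε hη p ≤ j₀ → (p : ℝ) < grid D ε (eta ε) (j₀ + 1) := fun p hp =>
    (lt_grid_boxIdx_succ hD hε hη p).trans_le (grid_mono hD1 hη.le (by omega))
  intro p hp
  have hmn0 : m * n ≠ 0 := (Nat.mem_primeFactors.mp hp).2.2
  have hm0 : m ≠ 0 := left_ne_zero_of_mul hmn0
  have hn0 : n ≠ 0 := right_ne_zero_of_mul hmn0
  have hpp : p.Prime := Nat.prime_of_mem_primeFactors hp
  rw [Nat.primeFactors_mul hm0 hn0, Finset.mem_union] at hp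
  rcases hp with hpm | hpn
  · -- `p ∣ m`: either `p ∣ (m, P(u))`, so `p < u ≤ D_{j₀+1}`, or `p ∣ m/(m, P(u))`, whose pattern is `k_M`
    by_cases hpg : p ∣ Nat.gcd m Ps
    · have hpu : p ∣ Ps := hpg.trans (Nat.gcd_dvd_right _ _)
      rw [hPs, dvd_primesProdBelow_iff hpp] at hpu
      refine hpu.trans_le ?_
      rw [uu]; exact grid_mono hD1 hη.le (Nat.zero_le _)
    · have hg0 : Nat.gcd m Ps ≠ 0 := Nat.gcd_ne_zero_left hm0
      have hm : m = Nat.gcd m Ps * (m / Nat.gcd m Ps) := (Nat.mul_div_cancel' (Nat.gcd_dvd_left _ _)).symm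
      have hpdiv : p ∣ m / Nat.gcd m Ps := by
        have := (Nat.mem_primeFactors.mp hpm).2.1
        rw [hm] at this
        exact ((Nat.Prime.dvd_mul hpp).mp this).resolve_left hpg
      have hq0 : m / Nat.gcd m Ps ≠ 0 := by
        intro h0; rw [h0, mul_zero] at hm; exact hm0 hm
      have hmem : boxIdx hD hε hη p ∈ pat hD hε hη (m / Nat.gcd m Ps) :=
        (mem_pat_iff hD hε hη).mpr ⟨p, Nat.mem_primeFactors.mpr ⟨hpp, hpdiv, hq0⟩, rfl⟩
      rw [hpatm] at hmem
      exact hbox p (hM_le _ hmem)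
  · have hmem : boxIdx hD hε hη p ∈ pat hD hε hη n := (mem_pat_iff hD hε hη).mpr ⟨p, hpn, rfl⟩
    rw [hB'.2] at hmem
    exact hbox p (hN_le _ hmem)

end Support

/-! ### Support of the upper-sieve rows -/

section SupportOne

variable {D ε : ℝ} (hD : 1 < D) (hε : 0 < ε)
include hD hε

omit hD hε in
/-- For an upper-admissible pattern every box `j` has `D_{j+1}³ < D` (the condition at the last, largest box).
[cite: IwaniecActaArith1980b, p. 311 (𝒟⁺)] -/
theorem grid_cube_lt_of_admC_one {η : ℝ} (hD1 : 1 ≤ D) (hη : 0 ≤ η) :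
    ∀ {k : Multiset ℕ}, AdmC (D := D) (ε := ε) (η := η) 1 k → ∀ j ∈ k, grid D ε η (j + 1) ^ 3 < D := by
  intro k
  induction hn : Multiset.card k using Nat.strong_induction_on generalizing k with
  | _ n ih =>
    intro hadm j hj
    have hk : k ≠ 0 := by rintro rfl; simp at hj
    have hjk : mmin k ∈ k := mmin_mem hk
    rw [admC_iff hk] at hadm
    have hlt : Multiset.card (k.erase (mmin k)) < n := by
      rw [← hn, Multiset.card_erase_of_mem hjk]
      exact Nat.pred_lt (by rw [Ne, Multiset.card_eq_zero]; exact hk)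
    have ih' := ih _ hlt rfl hadm.1
    by_cases hje : j ∈ k.erase (mmin k)
    · exact ih' j hje
    · -- `j = mmin k`; either `k = {j}` (then `condK k` is the claim) or some larger box is in `k.erase`
      have hjm : j = mmin k := by
        by_contra hne; exact hje ((Multiset.mem_erase_of_ne hne).mpr hj)
      by_cases hk1 : k.erase (mmin k) = 0
      · have hk' : k = {mmin k} := by rw [← Multiset.cons_erase hjk, hk1]; rfl
        have hcard : Multiset.card k % 2 = 1 % 2 := by rw [hk']; simp
        have hc := hadm.2 hcard
        unfold condK at hc
        rw [hk', show ({mmin k} : Multiset ℕ) = mmin k ::ₘ 0 from rfl, bprod_cons, bprod_zero, mul_one,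
          show (mmin k ::ₘ 0 : Multiset ℕ) = {mmin k} from rfl, mmin_singleton] at hc
        rw [hjm]; nlinarith [hc]
      · obtain ⟨j', hj'⟩ := Multiset.exists_mem_of_ne_zero hk1
        have hle : mmin k ≤ j' := mmin_le (Multiset.mem_of_mem_erase hj')
        have h1 := ih' j' hj'
        have hmono : grid D ε η (j + 1) ≤ grid D ε η (j' + 1) := grid_mono hD1 hη (by omega)
        have h0 : 0 ≤ grid D ε η (j + 1) := (grid_pos (by linarith) _).le
        calc grid D ε η (j + 1) ^ 3 ≤ grid D ε η (j' + 1) ^ 3 := pow_le_pow_left₀ h0 hmono 3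
          _ < D := h1

/-- **Support of the upper rows, `m`-side**: `a⁺_{m,l} ≠ 0` forces `p³ < D` for every prime `p ∣ m`
(`ε ≤ 1/3`: the small-composite primes are `< u = D^{ε²}`, the pattern primes lie in upper-admissible boxes).
[folklore] -/
theorem cube_lt_of_cA_one_ne_zero (hε3 : ε ≤ 1 / 3) (j₀ : ℕ) (Mb : ℝ) {l m : ℕ}
    (h : cA hD hε 1 j₀ Mb l m ≠ 0) : ∀ p ∈ m.primeFactors, (p : ℝ) ^ 3 < D := by
  have hη := eta_pos hε
  have hD0 : (0:ℝ) < D := by linarith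
  set U := Univ hD hε with hU
  set Ps := primesProdBelow (uu D ε) with hPs
  set k := patOf U l with hk
  have hA' : Lamk (D := D) (ε := ε) 1 j₀ k ≠ 0 ∧
      pat hD hε hη (m / Nat.gcd m Ps) = (splitK (D := D) (ε := ε) (η := eta ε) Mb k).1 := by
    unfold cA coefA at h
    split_ifs at h with hl
    · refine ⟨?_, ?_⟩
      · intro h0; apply h; unfold aCoef; rw [← hk, h0]; simp
      · by_contra h0; apply h; unfold aCoef; rw [← hk, if_neg h0]; simp
    · exact absurd rfl h
  obtain ⟨hlam, hpatm⟩ := hA'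
  have hadm : AdmC (D := D) (ε := ε) (η := eta ε) 1 k := by
    by_contra h0; apply hlam; unfold Lamk; rw [if_neg (fun hc => h0 hc.1), mul_zero]
  have hcube := grid_cube_lt_of_admC_one (ε := ε) hD.le hη.le hadm
  have hsplit := splitK_union (D := D) (ε := ε) (η := eta ε) (Mb := Mb) k
  intro p hp
  have hm0 : m ≠ 0 := (Nat.mem_primeFactors.mp hp).2.2
  have hpp : p.Prime := Nat.prime_of_mem_primeFactors hp
  by_cases hpg : p ∣ Nat.gcd m Ps
  · -- `p < u = D^{ε²}`, `u³ ≤ D`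
    have hpu : p ∣ Ps := hpg.trans (Nat.gcd_dvd_right _ _)
    rw [hPs, dvd_primesProdBelow_iff hpp, uu_def] at hpu
    have hp0 : (0:ℝ) ≤ p := Nat.cast_nonneg p
    calc (p : ℝ) ^ 3 < (D ^ (ε ^ 2)) ^ 3 := pow_lt_pow_left₀ hpu hp0 (by norm_num)
      _ = D ^ (3 * ε ^ 2) := by rw [← Real.rpow_natCast, ← Real.rpow_mul hD0.le]; ring_nf
      _ ≤ D ^ (1:ℝ) := Real.rpow_le_rpow_of_exponent_le hD.le (by nlinarith)
      _ = D := Real.rpow_one D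
  · have hm : m = Nat.gcd m Ps * (m / Nat.gcd m Ps) := (Nat.mul_div_cancel' (Nat.gcd_dvd_left _ _)).symm
    have hpdiv : p ∣ m / Nat.gcd m Ps := by
      have := (Nat.mem_primeFactors.mp hp).2.1
      rw [hm] at this
      exact ((Nat.Prime.dvd_mul hpp).mp this).resolve_left hpg
    have hq0 : m / Nat.gcd m Ps ≠ 0 := by intro h0; rw [h0, mul_zero] at hm; exact hm0 hm
    have hmem : boxIdx hD hε hη p ∈ pat hD hε hη (m / Nat.gcd m Ps) :=
      (mem_pat_iff hD hε hη).mpr ⟨p, Nat.mem_primeFactors.mpr ⟨hpp, hpdiv, hq0⟩, rfl⟩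
    rw [hpatm] at hmem
    have hjk : boxIdx hD hε hη p ∈ k := by rw [← hsplit]; exact Multiset.mem_add.mpr (Or.inl hmem)
    have h1 := hcube _ hjk
    have h2 := lt_grid_boxIdx_succ hD hε hη p
    have hp0 : (0:ℝ) ≤ p := Nat.cast_nonneg p
    exact (pow_lt_pow_left₀ h2 hp0 (by norm_num)).trans h1

/-- **Support of the upper rows, `n`-side**: `a⁺_{m,l} ≠ 0` and `b_{n,l} ≠ 0` force `p³ < D` for every prime
`p ∣ n`. [folklore] -/
theorem cube_lt_of_cA_one_cB_ne_zero (j₀ : ℕ) (Mb : ℝ) {l m n : ℕ}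
    (hA : cA hD hε 1 j₀ Mb l m ≠ 0) (hB : cB hD hε Mb l n ≠ 0) : ∀ p ∈ n.primeFactors, (p : ℝ) ^ 3 < D := by
  have hη := eta_pos hε
  set U := Univ hD hε with hU
  set k := patOf U l with hk
  have hlk : l < U.card ∧ Lamk (D := D) (ε := ε) 1 j₀ k ≠ 0 := by
    unfold cA coefA at hA
    split_ifs at hA with hl
    · exact ⟨hl, fun h0 => hA (by unfold aCoef; rw [← hk, h0]; simp)⟩
    · exact absurd rfl hA
  obtain ⟨hl, hlam⟩ := hlk
  have hB' : pat hD hε hη n = (splitK (D := D) (ε := ε) (η := eta ε) Mb k).2 := by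
    unfold cB coefB bCoef at hB
    rw [if_pos hl, ← hk] at hB
    by_contra h0; exact hB (if_neg fun hc => h0 hc.2)
  have hadm : AdmC (D := D) (ε := ε) (η := eta ε) 1 k := by
    by_contra h0; apply hlam; unfold Lamk; rw [if_neg (fun hc => h0 hc.1), mul_zero]
  have hcube := grid_cube_lt_of_admC_one (ε := ε) hD.le hη.le hadm
  have hsplit := splitK_union (D := D) (ε := ε) (η := eta ε) (Mb := Mb) k
  intro p hp
  have hpp : p.Prime := Nat.prime_of_mem_primeFactors hp
  have hmem : boxIdx hD hε hη p ∈ pat hD hε hη n := (mem_pat_iff hD hε hη).mpr ⟨p, hp, rfl⟩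
  rw [hB'] at hmem
  have hjk : boxIdx hD hε hη p ∈ k := by rw [← hsplit]; exact Multiset.mem_add.mpr (Or.inr hmem)
  have hp0 : (0:ℝ) ≤ p := Nat.cast_nonneg p
  exact (pow_lt_pow_left₀ (lt_grid_boxIdx_succ hD hε hη p) hp0 (by norm_num)).trans (hcube _ hjk)

/-- **Range of the upper rows**: `a⁺_{m,l} ≠ 0` with `m` squarefree forces `m < D^ε M'^{1+η}`
(`M' N' = D`, `M', N' ≥ 1`). [cite: IwaniecActaArith1980b, (9) p. 309] -/
theorem lt_of_cA_one_ne_zero (hε3 : ε ≤ 1 / 3) (j₀ : ℕ) {Mb Nb : ℝ} (hMb : 1 ≤ Mb) (hNb : 1 ≤ Nb)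
    (hMN : Mb * Nb = D) {l m : ℕ} (hm : Squarefree m) (h : cA hD hε 1 j₀ Mb l m ≠ 0) :
    (m : ℝ) < D ^ ε * Mb ^ (1 + eta ε) := by
  have hη := eta_pos hε
  have hD0 : (0:ℝ) < D := by linarith
  set U := Univ hD hε with hU
  set Ps := primesProdBelow (uu D ε) with hPs
  set k := patOf U l with hk
  unfold cA coefA at h
  split_ifs at h with hl
  swap; · exact absurd rfl h
  rw [← hk] at h
  have hlam : Lamk (D := D) (ε := ε) 1 j₀ k ≠ 0 := fun h0 => h (by unfold aCoef; rw [h0]; simp)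
  have hadm : AdmC (D := D) (ε := ε) (η := eta ε) 1 k := by
    by_contra h0; apply hlam; unfold Lamk; rw [if_neg (fun hc => h0 hc.1), mul_zero]
  have hhyp : HypL1 (D := D) (ε := ε) (η := eta ε) k :=
    hypL1_of_admC hD.le hη.le 1 hadm (by norm_num)
  obtain ⟨-, hM', -⟩ := splitK_spec (D := D) (ε := ε) (η := eta ε) hD0 hMb hNb hMN hhyp
  have hφ : ∀ e, phiOf 1 (phi D ε 1) (phi D ε 0) (Lamk (D := D) (ε := ε) 1 j₀) k e ≠ 0 → (e : ℝ) < D ^ ε := by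
    intro e he
    unfold phiOf BetaSieve.innerSel at he
    split_ifs at he
    · exact lt_of_phi_ne_zero hD hε hε3 _ he
    · exact lt_of_phi_ne_zero hD hε hε3 _ he
  have hlt := lt_of_aCoef_ne_zero hD hε hη hφ hm h
  refine hlt.trans_le (mul_le_mul_of_nonneg_left ?_ (Real.rpow_nonneg hD0.le _))
  rw [bprod_eq_lprod_rpow hD0.le]
  exact Real.rpow_le_rpow (lprod_pos hD0 _).le hM' (by linarith)

end SupportOne

/-! ### The top box -/

section TopBox

variable {D ε : ℝ} (hD : 1 < D) (hε : 0 < ε)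
include hD hε

/-- The index `j*` of the box containing `⌊√D⌋`. [folklore] -/
def jstar : ℕ := boxIdx hD hε (eta_pos hε) ⌊Real.sqrt D⌋₊

/-- `D_{j*} ≤ √D` (when `u + 1 ≤ √D`). [folklore] -/
theorem grid_jstar_le (hu : uu D ε + 1 ≤ Real.sqrt D) : grid D ε (eta ε) (jstar hD hε) ≤ Real.sqrt D := by
  have hfl : (⌊Real.sqrt D⌋₊ : ℝ) ≤ Real.sqrt D := Nat.floor_le (Real.sqrt_nonneg D)
  refine le_trans (grid_boxIdx_le hD hε (eta_pos hε) ?_) hfl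
  have := Nat.lt_floor_add_one (Real.sqrt D)
  rw [← uu]; linarith

/-- `√D − 1 < D_{j*+1} = D_{j*}^{1+η}`. [folklore] -/
theorem lt_grid_jstar_succ : Real.sqrt D - 1 < grid D ε (eta ε) (jstar hD hε + 1) := by
  have h := lt_grid_boxIdx_succ hD hε (eta_pos hε) ⌊Real.sqrt D⌋₊
  have := Nat.lt_floor_add_one (Real.sqrt D)
  rw [jstar]; linarith

/-- `1 ≤ j*` as soon as `D_1 + 1 ≤ √D`. [folklore] -/
theorem one_le_jstar (h1 : grid D ε (eta ε) 1 + 1 ≤ Real.sqrt D) : 1 ≤ jstar hD hε := by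
  by_contra h0
  have hj : jstar hD hε = 0 := by omega
  have h := lt_grid_boxIdx_succ hD hε (eta_pos hε) ⌊Real.sqrt D⌋₊
  rw [← jstar, hj, zero_add] at h
  have := Nat.lt_floor_add_one (Real.sqrt D)
  linarith

end TopBox

end Core

/-! ### Buchstab's inequality for finite integer sequences -/

/-- **Buchstab's inequality** (one-sided form of Buchstab's identity): for `y₁ ≤ Δ ≤ z`,
`S(ℬ, Δ) ≤ S(ℬ, z) + ∑_{Δ ≤ p < z} S(ℬ_p, y₁)`: an element coprime to `P(Δ)` but not to `P(z)` has a prime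
factor `p ∈ [Δ, z)` and is coprime to `P(y₁)`. [cite: IwaniecActaArith1980b, p. 308 ("by Buchstab's identity")] -/
theorem card_sifted_buchstab (B : Multiset ℤ) {y₁ Δ : ℝ} (z : ℝ) (hy : y₁ ≤ Δ) :
    ((B.filter fun b : ℤ => Int.gcd b (primesProdBelow Δ) = 1).card : ℝ) ≤
      (B.filter fun b : ℤ => Int.gcd b (primesProdBelow z) = 1).card +
        ∑ p ∈ (Nat.primesBelow ⌈z⌉₊).filter (fun p : ℕ => Δ ≤ (p : ℝ)),
          (((B.filter fun b : ℤ => (p : ℤ) ∣ b).filter fun b : ℤ => Int.gcd b (primesProdBelow y₁) = 1).card : ℝ) := by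
  classical
  set T := (Nat.primesBelow ⌈z⌉₊).filter (fun p : ℕ => Δ ≤ (p : ℝ)) with hT
  induction B using Multiset.induction_on with
  | empty => simp
  | cons b B ih =>
    simp only [Multiset.filter_cons, Multiset.filter_add, Multiset.card_add, Nat.cast_add, Finset.sum_add_distrib]
    -- the pointwise inequality for the new element `b`
    have hpt : (((if Int.gcd b (primesProdBelow Δ) = 1 then ({b} : Multiset ℤ) else 0).card : ℕ) : ℝ) ≤
        (((if Int.gcd b (primesProdBelow z) = 1 then ({b} : Multiset ℤ) else 0).card : ℕ) : ℝ) +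
          ∑ p ∈ T, ((Multiset.filter (fun b : ℤ => Int.gcd b (primesProdBelow y₁) = 1)
            (if (p : ℤ) ∣ b then ({b} : Multiset ℤ) else 0)).card : ℝ) := by
      have hnn : ∀ p ∈ T, (0 : ℝ) ≤ ((Multiset.filter (fun b : ℤ => Int.gcd b (primesProdBelow y₁) = 1)
          (if (p : ℤ) ∣ b then ({b} : Multiset ℤ) else 0)).card : ℝ) := fun _ _ => Nat.cast_nonneg _
      by_cases hz : Int.gcd b (primesProdBelow z) = 1
      · rw [if_pos hz]
        have : (((if Int.gcd b (primesProdBelow Δ) = 1 then ({b} : Multiset ℤ) else 0).card : ℕ) : ℝ) ≤ 1 := by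
          split_ifs <;> simp
        have h2 := Finset.sum_nonneg hnn
        simp only [Multiset.card_singleton, Nat.cast_one]
        linarith
      by_cases hΔ : Int.gcd b (primesProdBelow Δ) = 1
      swap
      · rw [if_neg hΔ]; simp only [Multiset.card_zero, Nat.cast_zero]
        have h2 := Finset.sum_nonneg hnn
        positivity
      -- a prime `p ∣ (b, P(z))` with `p ∤ P(Δ)`
      obtain ⟨p, hp, hpdvd⟩ := Nat.exists_prime_and_dvd hz
      have hpz : p ∣ primesProdBelow z := (Nat.dvd_gcd_iff.mp hpdvd).2 |>.trans (by rfl) |> fun h => by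
        have := Int.gcd_dvd_right b (primesProdBelow z)
        exact Int.natCast_dvd_natCast.mp ((Int.natCast_dvd_natCast.mpr hpdvd).trans this)
      have hpb : (p : ℤ) ∣ b := (Int.natCast_dvd_natCast.mpr hpdvd).trans (Int.gcd_dvd_left _ _)
      have hplt : (p : ℝ) < z := (dvd_primesProdBelow_iff hp z).mp hpz
      have hpΔ : Δ ≤ (p : ℝ) := by
        by_contra hlt
        have h1 : p ∣ primesProdBelow Δ := (dvd_primesProdBelow_iff hp Δ).mpr (not_le.mp hlt)
        have h2 : (p : ℕ) ∣ Int.gcd b (primesProdBelow Δ) := (BetaSieve.dvd_int_gcd_iff h1 b).mpr hpb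
        rw [hΔ] at h2
        exact hp.one_lt.ne' (Nat.dvd_one.mp h2)
      have hpT : p ∈ T := by
        rw [hT, Finset.mem_filter, Nat.mem_primesBelow]
        exact ⟨⟨Nat.lt_ceil.mpr hplt, hp⟩, hpΔ⟩
      -- `b` is coprime to `P(y₁)`
      have hy₁ : Int.gcd b (primesProdBelow y₁) = 1 := by
        have hdvd : primesProdBelow y₁ ∣ primesProdBelow Δ := SieveSequence.primesProdBelow_dvd hy
        have : Int.gcd b (primesProdBelow y₁) ∣ Int.gcd b (primesProdBelow Δ) := by
          rw [Int.gcd, Int.gcd, Int.natAbs_natCast, Int.natAbs_natCast]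
          exact Nat.gcd_dvd_gcd_of_dvd_right _ hdvd
        rw [hΔ] at this
        exact Nat.dvd_one.mp this
      have hterm : (1 : ℝ) ≤ ((Multiset.filter (fun b : ℤ => Int.gcd b (primesProdBelow y₁) = 1)
          (if (p : ℤ) ∣ b then ({b} : Multiset ℤ) else 0)).card : ℝ) := by
        rw [if_pos hpb, Multiset.filter_singleton, if_pos hy₁]; simp
      have hsum := Finset.single_le_sum hnn hpT
      rw [if_pos hΔ, if_neg hz]
      simp only [Multiset.card_singleton, Nat.cast_one, Multiset.card_zero, Nat.cast_zero]
      linarith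
    linarith

/-- `#{b ∈ ℬ_p : d ∣ b} = #{b ∈ ℬ : pd ∣ b}` for `(p, d) = 1`. [folklore] -/
theorem card_filter_filter_dvd (B : Multiset ℤ) {p d : ℕ} (hpd : Nat.Coprime p d) :
    ((B.filter fun b : ℤ => (p : ℤ) ∣ b).filter fun b : ℤ => (d : ℤ) ∣ b).card =
      (B.filter fun b : ℤ => ((p * d : ℕ) : ℤ) ∣ b).card := by
  rw [Multiset.filter_filter]
  congr 1
  refine Multiset.filter_congr fun b _ => ?_
  constructor
  · rintro ⟨hd, hp⟩
    push_cast
    exact (Nat.isCoprime_iff_coprime.mpr hpd).mul_dvd hp hd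
  · intro h
    push_cast at h
    exact ⟨(dvd_mul_left _ _).trans h, (dvd_mul_right _ _).trans h⟩

namespace Core

/-! ### The strengthened crude regime -/

section Crude

variable {D ε : ℝ} (hD : 1 < D) (hε : 0 < ε) {g : ArithmeticFunction ℝ} {K : ℝ} (hK1 : 1 ≤ K)
  (h1 : ∀ w z : ℝ, 2 ≤ w → w < z →
    ∏ p ∈ (Nat.primesBelow ⌈z⌉₊).filter (fun p : ℕ => w ≤ (p : ℝ)), (1 - g p)⁻¹ ≤
      Real.log z / Real.log w * (1 + K / Real.log w))
include hD hε hK1 h1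

omit hD hε hK1 h1 in
/-- Monotonicity of `t + 12.5 K² t³ + 44 K³ t⁴` (auxiliary). [folklore] -/
theorem crude_aux3 {K t T : ℝ} (hK : 0 ≤ K) (ht : 0 ≤ t) (htT : t ≤ T) :
    (1 + 12.5 * K ^ 2 * t ^ 2 + 44 * K ^ 3 * t ^ 3) * t ≤ T + 12.5 * K ^ 2 * T ^ 3 + 44 * K ^ 3 * T ^ 4 := by
  have h3 : t ^ 3 ≤ T ^ 3 := pow_le_pow_left₀ ht htT 3
  have h4 : t ^ 4 ≤ T ^ 4 := pow_le_pow_left₀ ht htT 4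
  have hK2 : 0 ≤ K ^ 2 := sq_nonneg K
  have hK3 : 0 ≤ K ^ 3 := pow_nonneg hK 3
  nlinarith [mul_le_mul_of_nonneg_left h3 hK2, mul_le_mul_of_nonneg_left h4 hK3]

omit hD h1 in
/-- **The crude regime, strengthened key inequality**: outside the main regime,
`1 + 12.5 K² (log D)² + 44 K³ (log D)³ ≤ 10²⁸ (ε + ε⁻⁸ eᴷ/log D)` (so that `1 + V⁻² + V⁻³ ≪ err`). [folklore] -/
theorem crude_key3 {t : ℝ} (hε3 : ε ≤ 1 / 3) (ht : 0 < t)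
    (hcase : t < 200 * K * ε⁻¹ ^ 2 ∨ t < 4e4 * K ^ 2 ∨ t < 900 * ε⁻¹ ^ 2 ∨ (t ≤ ε⁻¹ ^ 4 ∧ 1 / 30 < ε)) :
    1 + 12.5 * K ^ 2 * t ^ 2 + 44 * K ^ 3 * t ^ 3 ≤ 1e28 * (ε + ε⁻¹ ^ 8 * Real.exp K / t) := by
  have hK0 : 0 ≤ K := by linarith
  have hεi : 3 ≤ ε⁻¹ := by rw [le_inv_comm₀ (by norm_num) hε]; linarith
  have hεi1 : 1 ≤ ε⁻¹ := by linarith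
  have he28 : ε⁻¹ ^ 2 ≤ ε⁻¹ ^ 8 := pow_le_pow_right₀ hεi1 (by norm_num)
  have he48 : ε⁻¹ ^ 4 ≤ ε⁻¹ ^ 8 := pow_le_pow_right₀ hεi1 (by norm_num)
  have he68 : ε⁻¹ ^ 6 ≤ ε⁻¹ ^ 8 := pow_le_pow_right₀ hεi1 (by norm_num)
  have he08 : 1 ≤ ε⁻¹ ^ 8 := one_le_pow₀ hεi1
  obtain ⟨hK11, -, hK1e⟩ := pow_exp_bounds hK0
  have hfac : ∀ n : ℕ, K ^ n ≤ (n.factorial : ℝ) * Real.exp K := fun n => pow_le_factorial_mul_exp hK0 n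
  have hK2 : K ^ 2 ≤ 2 * Real.exp K := by
    have := hfac 2; rwa [show ((Nat.factorial 2 : ℕ) : ℝ) = 2 by norm_num [Nat.factorial]] at this
  have hK3 : K ^ 3 ≤ 6 * Real.exp K := by
    have := hfac 3; rwa [show ((Nat.factorial 3 : ℕ) : ℝ) = 6 by norm_num [Nat.factorial]] at this
  have hK5 : K ^ 5 ≤ 120 * Real.exp K := by
    have := hfac 5; rwa [show ((Nat.factorial 5 : ℕ) : ℝ) = 120 by norm_num [Nat.factorial]] at this
  have hK7 : K ^ 7 ≤ 5040 * Real.exp K := by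
    have := hfac 7; rwa [show ((Nat.factorial 7 : ℕ) : ℝ) = 5040 by norm_num [Nat.factorial]] at this
  have hK8 : K ^ 8 ≤ 40320 * Real.exp K := by
    have := hfac 8; rwa [show ((Nat.factorial 8 : ℕ) : ℝ) = 40320 by norm_num [Nat.factorial]] at this
  have heK : 1 ≤ Real.exp K := by linarith
  have heK0 : 0 < Real.exp K := Real.exp_pos K
  suffices h : (1 + 12.5 * K ^ 2 * t ^ 2 + 44 * K ^ 3 * t ^ 3) * t ≤ 1e28 * (ε⁻¹ ^ 8 * Real.exp K) by
    have h' : 1 + 12.5 * K ^ 2 * t ^ 2 + 44 * K ^ 3 * t ^ 3 ≤ 1e28 * (ε⁻¹ ^ 8 * Real.exp K / t) := by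
      rw [mul_div_assoc', le_div_iff₀ ht]; exact h
    nlinarith [hε.le]
  set X := ε⁻¹ ^ 8 * Real.exp K with hX
  have hX0 : 0 ≤ X := by positivity
  have hXe : Real.exp K ≤ X := by rw [hX]; nlinarith
  rcases hcase with hc | hc | hc | ⟨hc, hε30⟩
  · refine (crude_aux3 hK0 ht.le hc.le).trans ?_
    have h1 : 200 * K * ε⁻¹ ^ 2 ≤ 200 * X := by
      rw [hX]; nlinarith [mul_le_mul hK1e he28 (by positivity) heK0.le]
    have h2 : 12.5 * K ^ 2 * (200 * K * ε⁻¹ ^ 2) ^ 3 = 1e8 * (K ^ 5 * ε⁻¹ ^ 6) := by ring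
    have h3 : K ^ 5 * ε⁻¹ ^ 6 ≤ 120 * X := by
      rw [hX]; nlinarith [mul_le_mul hK5 he68 (by positivity) (by positivity)]
    have h4 : 44 * K ^ 3 * (200 * K * ε⁻¹ ^ 2) ^ 4 = 7.04e10 * (K ^ 7 * ε⁻¹ ^ 8) := by ring
    have h5 : K ^ 7 * ε⁻¹ ^ 8 ≤ 5040 * X := by
      have := mul_le_mul_of_nonneg_right hK7 (by positivity : (0:ℝ) ≤ ε⁻¹ ^ 8)
      rw [hX]; linarith
    rw [h2, h4]; linarith
  · refine (crude_aux3 hK0 ht.le hc.le).trans ?_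
    have h1 : 4e4 * K ^ 2 ≤ 8e4 * X := by linarith
    have h2 : 12.5 * K ^ 2 * (4e4 * K ^ 2) ^ 3 = 8e14 * K ^ 8 := by ring
    have h3 : K ^ 8 ≤ 40320 * X := by linarith
    have h4 : 44 * K ^ 3 * (4e4 * K ^ 2) ^ 4 = 1.1264e20 * K ^ 11 := by ring
    have h5 : K ^ 11 ≤ 4e7 * X := by linarith
    rw [h2, h4]; linarith
  · refine (crude_aux3 hK0 ht.le hc.le).trans ?_
    have h1 : 900 * ε⁻¹ ^ 2 ≤ 900 * X := by
      rw [hX]; nlinarith [mul_le_mul he28 heK (by positivity) (by positivity)]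
    have h2 : 12.5 * K ^ 2 * (900 * ε⁻¹ ^ 2) ^ 3 = 9.1125e9 * (K ^ 2 * ε⁻¹ ^ 6) := by ring
    have h3 : K ^ 2 * ε⁻¹ ^ 6 ≤ 2 * X := by
      rw [hX]; nlinarith [mul_le_mul hK2 he68 (by positivity) (by positivity)]
    have h4 : 44 * K ^ 3 * (900 * ε⁻¹ ^ 2) ^ 4 = 2.88684e13 * (K ^ 3 * ε⁻¹ ^ 8) := by ring
    have h5 : K ^ 3 * ε⁻¹ ^ 8 ≤ 6 * X := by
      have := mul_le_mul_of_nonneg_right hK3 (by positivity : (0:ℝ) ≤ ε⁻¹ ^ 8)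
      rw [hX]; linarith
    rw [h2, h4]; linarith
  · refine (crude_aux3 hK0 ht.le hc).trans ?_
    have hε4 : ε⁻¹ ^ 4 ≤ 810000 := by
      have : ε⁻¹ < 30 := by rw [inv_lt_comm₀ hε (by norm_num)]; rw [one_div] at hε30; exact hε30
      calc ε⁻¹ ^ 4 ≤ (30:ℝ) ^ 4 := pow_le_pow_left₀ (by linarith) this.le 4
        _ = 810000 := by norm_num
    have h1 : ε⁻¹ ^ 4 ≤ X := by
      rw [hX]; nlinarith [mul_le_mul he48 heK (by positivity) (by positivity)]
    have h2 : 12.5 * K ^ 2 * (ε⁻¹ ^ 4) ^ 3 = 12.5 * (K ^ 2 * ε⁻¹ ^ 4) * ε⁻¹ ^ 8 := by ring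
    have h3 : K ^ 2 * ε⁻¹ ^ 4 ≤ 2 * Real.exp K * 810000 := mul_le_mul hK2 hε4 (by positivity) (by positivity)
    have h3' : 12.5 * (K ^ 2 * ε⁻¹ ^ 4) * ε⁻¹ ^ 8 ≤ 12.5 * (2 * Real.exp K * 810000) * ε⁻¹ ^ 8 :=
      mul_le_mul_of_nonneg_right (mul_le_mul_of_nonneg_left h3 (by norm_num)) (by positivity)
    have h3'' : 12.5 * (2 * Real.exp K * 810000) * ε⁻¹ ^ 8 = 2.025e7 * X := by rw [hX]; ring
    have h4 : 44 * K ^ 3 * (ε⁻¹ ^ 4) ^ 4 = 44 * (K ^ 3 * (ε⁻¹ ^ 4) ^ 2) * ε⁻¹ ^ 8 := by ring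
    have h5 : K ^ 3 * (ε⁻¹ ^ 4) ^ 2 ≤ 6 * Real.exp K * 810000 ^ 2 :=
      mul_le_mul hK3 (pow_le_pow_left₀ (by positivity) hε4 2) (by positivity) (by positivity)
    have h5' : 44 * (K ^ 3 * (ε⁻¹ ^ 4) ^ 2) * ε⁻¹ ^ 8 ≤ 44 * (6 * Real.exp K * 810000 ^ 2) * ε⁻¹ ^ 8 :=
      mul_le_mul_of_nonneg_right (mul_le_mul_of_nonneg_left h5 (by norm_num)) (by positivity)
    have h5'' : 44 * (6 * Real.exp K * 810000 ^ 2) * ε⁻¹ ^ 8 = 1.732104e14 * X := by rw [hX]; ring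
    rw [h2, h4]; linarith

/-- **The crude regime**: `1 + V(z)⁻² + V(z)⁻³ ≤ 10²⁸ (ε + ε⁻⁸ eᴷ/log D)` for `2 ≤ z ≤ D` outside the main
regime (`V(z)⁻¹ ≤ 3.53 K log D`). [folklore] -/
theorem crude_inv_vprod_bound (hε3 : ε ≤ 1 / 3)
    (hcase : Real.log D < 200 * K * ε⁻¹ ^ 2 ∨ Real.log D < 4e4 * K ^ 2 ∨ Real.log D < 900 * ε⁻¹ ^ 2 ∨
      (Real.log D ≤ ε⁻¹ ^ 4 ∧ 1 / 30 < ε))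
    (hpos : ∀ z : ℝ, 0 < BetaSieve.vprod g (primesProdBelow z)) {z : ℝ} (hz : 2 ≤ z) (hzD : z ≤ D) :
    1 + (BetaSieve.vprod g (primesProdBelow z))⁻¹ ^ 2 + (BetaSieve.vprod g (primesProdBelow z))⁻¹ ^ 3 ≤
      1e28 * (ε + ε⁻¹ ^ 8 * Real.exp K / Real.log D) := by
  have ht0 : 0 < Real.log D := Real.log_pos hD
  have hVi := inv_vprod_le_crude hD hK1 h1 hz hzD
  have hkey := crude_key3 hε hK1 hε3 ht0 hcase
  have hV0 : 0 ≤ (BetaSieve.vprod g (primesProdBelow z))⁻¹ := inv_nonneg.mpr (hpos z).le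
  have h2 : (BetaSieve.vprod g (primesProdBelow z))⁻¹ ^ 2 ≤ (3.53 * K * Real.log D) ^ 2 := pow_le_pow_left₀ hV0 hVi 2
  have h3 : (BetaSieve.vprod g (primesProdBelow z))⁻¹ ^ 3 ≤ (3.53 * K * Real.log D) ^ 3 := pow_le_pow_left₀ hV0 hVi 3
  have hK0' : 0 ≤ K := by linarith
  have hK0 : 0 ≤ K * Real.log D := by positivity
  nlinarith [pow_nonneg hK0 2, pow_nonneg hK0 3, hkey, h2, h3]

end Crude

/-! ### Counting the bilinear forms -/

section Count

/-- The a-priori bound `J_b = ⌈2 ε⁻¹¹⌉` for the number of boxes. [folklore] -/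
def Jb (ε : ℝ) : ℕ := ⌈2 * ε⁻¹ ^ 11⌉₊

/-- The a-priori bound `L₁(ε) = (R + 1) J_b^R` for the number of patterns. [folklore] -/
def Lone (ε : ℝ) : ℕ := (Rnat ε + 1) * Jb ε ^ Rnat ε

variable {D ε : ℝ} (hD : 1 < D) (hε : 0 < ε)
include hD hε

/-- `J ≤ J_b`: the grid passes `⌈D⌉` after at most `⌈2ε⁻¹¹⌉` steps (`(1+η)^j ≥ 1 + jη`, `η = ε⁹`, `D ≥ 2`).
[folklore] -/
theorem Jnat_le_Jb (hD2 : 2 ≤ D) : Jnat hD hε ≤ Jb ε := by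
  have hη := eta_pos hε
  have hJb : 1 ≤ Jb ε := Nat.one_le_iff_ne_zero.mpr (by
    rw [Jb, Ne, Nat.ceil_eq_zero, not_le]; positivity)
  -- `⌈D⌉ < grid (Jb)`
  have hgrid : (⌈D⌉₊ : ℝ) < grid D ε (eta ε) (Jb ε - 1 + 1) := by
    rw [Nat.sub_add_cancel hJb, grid]
    have hexp : 2 ≤ ε ^ 2 * (1 + eta ε) ^ Jb ε := by
      have hb : 1 + (Jb ε : ℝ) * eta ε ≤ (1 + eta ε) ^ Jb ε := one_add_mul_le_pow (by linarith) _
      have hJ : 2 * ε⁻¹ ^ 11 ≤ (Jb ε : ℝ) := Nat.le_ceil _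
      have h1 : ε ^ 2 * (1 + (Jb ε : ℝ) * eta ε) ≥ 2 := by
        rw [eta]
        have : ε ^ 2 * (1 + 2 * ε⁻¹ ^ 11 * ε ^ 9) = ε ^ 2 + 2 := by field_simp
        nlinarith [mul_le_mul_of_nonneg_right hJ (by positivity : (0:ℝ) ≤ ε ^ 9), sq_nonneg ε]
      nlinarith [mul_le_mul_of_nonneg_left hb (by positivity : (0:ℝ) ≤ ε ^ 2)]
    have hD1 : (1:ℝ) ≤ D := hD.le
    calc (⌈D⌉₊ : ℝ) < D + 1 := Nat.ceil_lt_add_one (by linarith)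
      _ ≤ D ^ (2:ℝ) := by rw [Real.rpow_two]; nlinarith
      _ ≤ D ^ (ε ^ 2 * (1 + eta ε) ^ Jb ε) := Real.rpow_le_rpow_of_exponent_le hD1 hexp
  have := boxIdx_le_of_lt hD hε hη hgrid
  rw [Jnat]; omega

/-- **The number of patterns is bounded in terms of `ε` alone**: `#𝒰 ≤ L₁(ε)`. [cite: IwaniecActaArith1980b, p. 308] -/
theorem card_Univ_le (hD2 : 2 ≤ D) : (Univ hD hε).card ≤ Lone ε := by
  have hJ : 1 ≤ Jnat hD hε := Nat.le_add_left _ _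
  refine (card_patternsLe_le hJ _).trans ?_
  rw [Lone]
  exact Nat.mul_le_mul_left _ (Nat.pow_le_pow_left (Jnat_le_Jb hD hε hD2) _)

omit hD in
/-- **"Less than `exp(8 ε⁻³)` bilinear forms"**: `2 L₁(ε) + 2 ≤ exp(8 ε⁻³)` for `0 < ε ≤ 1/3`.
[cite: IwaniecActaArith1980b, Theorem 1 p. 308] -/
theorem two_Lone_add_two_le (hε3 : ε ≤ 1 / 3) : (2 * Lone ε + 2 : ℝ) ≤ Real.exp (8 * ε⁻¹ ^ 3) := by
  set x := ε⁻¹ with hx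
  have hx3 : 3 ≤ x := by rw [hx, le_inv_comm₀ (by norm_num) hε]; linarith
  have hx1 : 1 ≤ x := by linarith
  have hx0 : 0 < x := by linarith
  -- real bounds for `R` and `J_b`
  have hR : (Rnat ε : ℝ) ≤ x ^ 2 + 1 := by
    rw [Rnat]; push_cast
    have := Nat.floor_le (show (0:ℝ) ≤ ε⁻¹ ^ 2 by positivity)
    linarith
  have hR0 : (1 : ℝ) ≤ Rnat ε := by rw [Rnat]; push_cast; linarith [Nat.cast_nonneg (α := ℝ) ⌊ε⁻¹ ^ 2⌋₊]
  have hx11 : 1 ≤ x ^ 11 := one_le_pow₀ hx1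
  have hJ : (Jb ε : ℝ) ≤ 3 * x ^ 11 := by
    rw [Jb]
    have := Nat.ceil_lt_add_one (show (0:ℝ) ≤ 2 * ε⁻¹ ^ 11 by positivity)
    rw [← hx] at this; linarith
  have hJ1 : (1 : ℝ) ≤ Jb ε := by
    rw [Jb]; exact_mod_cast Nat.one_le_iff_ne_zero.mpr (by rw [Ne, Nat.ceil_eq_zero, not_le]; positivity)
  -- `L₁ = (R+1) J_b^R` as a real number, and its logarithm
  have hL : (Lone ε : ℝ) = ((Rnat ε : ℝ) + 1) * (Jb ε : ℝ) ^ Rnat ε := by rw [Lone]; push_cast; ring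
  have hJpos : (0 : ℝ) < Jb ε := by linarith
  have hlogJ : Real.log (Jb ε) ≤ 12 * Real.log x := by
    have hJ' : (Jb ε : ℝ) ≤ x ^ 12 := hJ.trans (by nlinarith)
    have := Real.log_le_log hJpos hJ'
    rwa [Real.log_pow, Nat.cast_ofNat] at this
  have hlogx : Real.log x ≤ x / 2 := by
    have := Real.log_le_sub_one_of_pos (show 0 < x / 2 by positivity)
    rw [Real.log_div hx0.ne' (by norm_num)] at this
    have := Real.log_two_lt_d9; linarith
  have hlog4 : Real.log 4 < 1.39 := by
    rw [show (4:ℝ) = 2 ^ 2 by norm_num, Real.log_pow]; have := Real.log_two_lt_d9; push_cast; linarith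
  have hlogR : Real.log ((Rnat ε : ℝ) + 1) ≤ (x ^ 2 + 2) / 2 := by
    have h1 := Real.log_le_sub_one_of_pos (show (0:ℝ) < ((Rnat ε : ℝ) + 1) / 2 by positivity)
    rw [Real.log_div (by positivity) (by norm_num)] at h1
    have := Real.log_two_lt_d9; linarith
  -- the main estimate `log(4 L₁) ≤ 8 x³`
  have hmain : Real.log 4 + Real.log ((Rnat ε : ℝ) + 1) + (Rnat ε : ℝ) * Real.log (Jb ε) ≤ 8 * x ^ 3 := by
    have hlogJ0 : 0 ≤ Real.log (Jb ε) := Real.log_nonneg hJ1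
    have h1 : (Rnat ε : ℝ) * Real.log (Jb ε) ≤ (x ^ 2 + 1) * (12 * (x / 2)) :=
      mul_le_mul hR (hlogJ.trans (by linarith)) hlogJ0 (by positivity)
    nlinarith
  have hexp : (4 : ℝ) * Lone ε ≤ Real.exp (8 * x ^ 3) := by
    have hpos : (0:ℝ) < 4 * Lone ε := by rw [hL]; positivity
    rw [← Real.exp_log hpos]
    refine Real.exp_le_exp.mpr (le_trans (le_of_eq ?_) hmain)
    rw [hL, Real.log_mul (by norm_num) (by positivity), Real.log_mul (by positivity) (by positivity),
      Real.log_pow]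
    ring
  have hL1 : (1 : ℝ) ≤ Lone ε := by
    rw [hL]; nlinarith [one_le_pow₀ (M₀ := ℝ) hJ1 (n := Rnat ε)]
  linarith

end Count

end Core

namespace Core

/-! ### The inner (linear) sieve of the Buchstab layer and its embedding into the bilinear rows -/

section Inner

variable {D' ε : ℝ} (hD' : 1 < D') (hε : 0 < ε)

/-- The `m'`-range `A' = D'^ε D'^{1+η}` of the inner linear sieve (level `D'`, `M' = D'`, `N' = 1`). [folklore] -/
def innerA (D' ε : ℝ) : ℝ := D' ^ ε * D' ^ (1 + eta ε)

/-- The combined inner coefficient `c_l(n) = a'_{n,l} b'_{1,l}` of the `l`-th inner form. [folklore] -/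
def rowInner (l n : ℕ) : ℝ := cA hD' hε 1 0 D' l n * cB hD' hε D' l 1

/-- The `l`-th inner form with the remainder `r'`: `∑_{m < A'} [m ∣ P(D')] c_l(m) r'(m)`. [folklore] -/
def innerForm (l : ℕ) (r' : ℕ → ℝ) : ℝ :=
  ∑ m ∈ Finset.Ico 1 ⌈innerA D' ε⌉₊, if m ∣ primesProdBelow D' then rowInner hD' hε l m * r' m else 0

/-- Case `M ≤ N³`: the `m`-row is the indicator of the primes `≥ Δ`. [folklore] -/
def aRowA (Δ : ℝ) (m : ℕ) : ℝ := if m.Prime ∧ Δ ≤ (m : ℝ) then 1 else 0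

/-- Case `N³ ≤ M`: the `m`-row carries the prime `p ≥ Δ` and the inner coefficient of `m/p`. [folklore] -/
def aRowB (Δ : ℝ) (l m : ℕ) : ℝ :=
  ∑ p ∈ m.primeFactors.filter (fun p : ℕ => Δ ≤ (p : ℝ)), rowInner hD' hε l (m / p)

/-- Case `N³ ≤ M`: the `n`-row is `[n = 1]`. [folklore] -/
def bRowB (n : ℕ) : ℝ := if n = 1 then 1 else 0

include hD' hε

/-- `|c_l(n)| ≤ 1`. [folklore] -/
theorem abs_rowInner_le_one (l n : ℕ) : |rowInner hD' hε l n| ≤ 1 := by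
  rw [rowInner, abs_mul]
  exact mul_le_one₀ (abs_cA_le_one hD' hε 1 0 D' l n) (abs_nonneg _) (abs_cB_le_one hD' hε D' l 1)

omit hD' hε in
/-- `|aRowA| ≤ 1`. [folklore] -/
theorem abs_aRowA_le_one (Δ : ℝ) (m : ℕ) : |aRowA Δ m| ≤ 1 := by
  unfold aRowA; split_ifs <;> simp

omit hD' hε in
/-- `|bRowB| ≤ 1`. [folklore] -/
theorem abs_bRowB_le_one (n : ℕ) : |bRowB n| ≤ 1 := by
  unfold bRowB; split_ifs <;> simp

/-- The primes of `n` are `< D'` when `c_l(n) ≠ 0` (`ε ≤ 1/3`). [folklore] -/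
theorem primeFactors_lt_of_rowInner_ne_zero (hε3 : ε ≤ 1 / 3) {l n : ℕ} (h : rowInner hD' hε l n ≠ 0) :
    ∀ q ∈ n.primeFactors, (q : ℝ) < D' := by
  intro q hq
  have hA : cA hD' hε 1 0 D' l n ≠ 0 := left_ne_zero_of_mul h
  have h3 := cube_lt_of_cA_one_ne_zero hD' hε hε3 0 D' hA q hq
  have hq1 : (1 : ℝ) ≤ q := by exact_mod_cast (Nat.prime_of_mem_primeFactors hq).one_lt.le
  have : (q : ℝ) ≤ (q : ℝ) ^ 3 := by
    calc (q : ℝ) = q * 1 * 1 := by ring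
      _ ≤ q * q * q := by gcongr
      _ = (q : ℝ) ^ 3 := by ring
  linarith

/-- **Localisation of the indicator**: for a prime `p ≥ Δ ≥ D'`, `D' ≤ z` and `n ≠ 0`,
`[pn ∣ P(z)] c_l(n) = [p < z] [n ∣ P(D')] c_l(n)`. [folklore] -/
theorem ite_mul_rowInner_eq (hε3 : ε ≤ 1 / 3) {Δ z : ℝ} (hΔ : D' ≤ Δ) (hz : D' ≤ z) {p : ℕ} (hp : p.Prime)
    (hpΔ : Δ ≤ (p : ℝ)) (l : ℕ) {n : ℕ} (hn0 : n ≠ 0) (x : ℝ) :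
    (if p * n ∣ primesProdBelow z then rowInner hD' hε l n * x else 0) =
      if (p : ℝ) < z ∧ n ∣ primesProdBelow D' then rowInner hD' hε l n * x else 0 := by
  by_cases h0 : rowInner hD' hε l n = 0
  · simp [h0]
  have hq := primeFactors_lt_of_rowInner_ne_zero hD' hε hε3 h0
  have hpn : Nat.Coprime p n := by
    rw [Nat.Prime.coprime_iff_not_dvd hp]
    intro hpn
    have := hq p (Nat.mem_primeFactors.mpr ⟨hp, hpn, hn0⟩)
    linarith
  by_cases hpz : (p : ℝ) < z
  · have hiff : p * n ∣ primesProdBelow z ↔ n ∣ primesProdBelow D' := by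
      constructor
      · intro h
        have hn : n ∣ primesProdBelow z := (dvd_mul_left n p).trans h
        have hnsq : Squarefree n := (squarefree_primesProdBelow z).squarefree_of_dvd hn
        exact BetaSieve.dvd_primesProdBelow_of_primeFactors_lt hnsq hq
      · intro h
        have hnsq : Squarefree n := (squarefree_primesProdBelow D').squarefree_of_dvd h
        have hn : n ∣ primesProdBelow z :=
          BetaSieve.dvd_primesProdBelow_of_primeFactors_lt hnsq fun q hq' => (hq q hq').trans_le hz
        have hpz' : p ∣ primesProdBelow z := (dvd_primesProdBelow_iff hp z).mpr hpz
        exact hpn.mul_dvd_of_dvd_of_dvd hpz' hn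
    simp only [hiff, hpz, true_and]
  · have hnot : ¬ p * n ∣ primesProdBelow z := fun h =>
      hpz ((dvd_primesProdBelow_iff hp z).mp ((dvd_mul_right p n).trans h))
    simp [hnot, hpz]

/-- `|aRowB| ≤ 1`: at most one prime `p ≥ Δ` of `m` can carry a non-zero inner coefficient `c_l(m/p)`
(the primes of `m/p` are `< D' ≤ Δ`). [folklore] -/
theorem abs_aRowB_le_one (hε3 : ε ≤ 1 / 3) {Δ : ℝ} (hΔ : D' ≤ Δ) (l m : ℕ) : |aRowB hD' hε Δ l m| ≤ 1 := by
  unfold aRowB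
  set T := m.primeFactors.filter (fun p : ℕ => Δ ≤ (p : ℝ)) with hT
  by_cases hall : ∀ p ∈ T, rowInner hD' hε l (m / p) = 0
  · rw [Finset.sum_eq_zero hall]; simp
  push Not at hall
  obtain ⟨p₀, hp₀T, hp₀⟩ := hall
  have hp₀' := Finset.mem_filter.mp hp₀T
  have hp₀p : p₀.Prime := Nat.prime_of_mem_primeFactors hp₀'.1
  have hm0 : m ≠ 0 := (Nat.mem_primeFactors.mp hp₀'.1).2.2
  rw [Finset.sum_eq_single_of_mem p₀ hp₀T]
  · exact abs_rowInner_le_one hD' hε l _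
  · intro p hpT hne
    have hp' := Finset.mem_filter.mp hpT
    have hpp : p.Prime := Nat.prime_of_mem_primeFactors hp'.1
    by_contra hne0
    -- `p ∣ m/p₀`, so `p < D' ≤ Δ ≤ p`
    have hq := primeFactors_lt_of_rowInner_ne_zero hD' hε hε3 hp₀
    have hm : m = p₀ * (m / p₀) := (Nat.mul_div_cancel' (Nat.dvd_of_mem_primeFactors hp₀'.1)).symm
    have hpdiv : p ∣ m / p₀ := by
      have := Nat.dvd_of_mem_primeFactors hp'.1
      rw [hm] at this
      refine ((Nat.Prime.dvd_mul hpp).mp this).resolve_left fun h => hne ?_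
      exact (Nat.prime_dvd_prime_iff_eq hpp hp₀p).mp h
    have hq0 : m / p₀ ≠ 0 := by intro h0; rw [h0, mul_zero] at hm; exact hm0 hm
    have := hq p (Nat.mem_primeFactors.mpr ⟨hpp, hpdiv, hq0⟩)
    linarith [hp'.2]

/-- **The inner identity**: `∑_{l < L'} innerForm_l(r') = ∑_{d ∣ P(D')} Λ'⁺(d) r'(d)`, the upper-sieve weights
of the inner construction (level `D'`, `M' = D'`, `N' = 1`, sifting range `P(D')`). [cite: IwaniecActaArith1980b, Theorem 1 (linear case `N = 1`)] -/
theorem sum_innerForm_eq (hε3 : ε ≤ 1 / 3) {L' : ℕ} (hL : (Univ hD' hε).card ≤ L') (r' : ℕ → ℝ) :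
    ∑ l ∈ Finset.range L', innerForm hD' hε l r' =
      ∑ d ∈ (primesProdBelow D').divisors, LamZ hD' hε 1 D' d * r' d := by
  have hD0 : (0:ℝ) < D' := by linarith
  have hη := eta_pos hε
  have hη1 : eta ε ≤ 1 := by
    rw [eta]; exact pow_le_one₀ hε.le (by linarith)
  have hΔ : grid D' ε (eta ε) (0 + 1) ^ 2 ≤ D' := by
    rw [zero_add, grid, pow_one, ← Real.rpow_natCast, ← Real.rpow_mul hD0.le]
    conv_rhs => rw [← Real.rpow_one D']
    refine Real.rpow_le_rpow_of_exponent_le hD'.le ?_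
    push_cast
    nlinarith [sq_nonneg ε, mul_pos hε hε]
  have h := sum_LamZ_mul_eq_bilinear hD' hε hε3 1 0 hΔ (Mb := D') (Nb := 1) hD'.le le_rfl (mul_one D')
    (A := innerA D' ε) (B := 2) le_rfl (by rw [Real.one_rpow]; norm_num) one_lt_two hL (z := D') le_rfl
    (fun h => absurd h (by norm_num)) r'
  rw [h]
  refine Finset.sum_congr rfl fun l _ => ?_
  rw [innerForm]
  refine Finset.sum_congr rfl fun m _ => ?_
  rw [show ⌈(2:ℝ)⌉₊ = 2 by norm_num, show Finset.Ico 1 2 = {1} by rfl, Finset.sum_singleton, mul_one, rowInner]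

/-- **Evaluation of the rows, case `M ≤ N³`** (`p` alone in the `m`-slot, the inner coefficients in the
`n`-slot): for `D' ≤ Δ`, `D' ≤ z ≤ M` and `⌈A'⌉ ≤ ⌈N⌉`,
`∑_{m<M} ∑_{n<N} [mn ∣ P(z)] aRowA(m) c_l(n) r(mn) = ∑_{Δ ≤ p < z} innerForm_l(r(p·))`. [folklore] -/
theorem rows_A_eval (hε3 : ε ≤ 1 / 3) {Δ z M N : ℝ} (hΔ : D' ≤ Δ) (hz : D' ≤ z) (hzM : z ≤ M)
    (hAN : ⌈innerA D' ε⌉₊ ≤ ⌈N⌉₊) (l : ℕ) (r : ℕ → ℝ) :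
    ∑ m ∈ Finset.Ico 1 ⌈M⌉₊, ∑ n ∈ Finset.Ico 1 ⌈N⌉₊,
        (if m * n ∣ primesProdBelow z then aRowA Δ m * rowInner hD' hε l n * r (m * n) else 0) =
      ∑ p ∈ (Nat.primesBelow ⌈z⌉₊).filter (fun p : ℕ => Δ ≤ (p : ℝ)), innerForm hD' hε l (fun d => r (p * d)) := by
  have hD0 : (0:ℝ) < D' := by linarith
  set Q : ℕ → Prop := fun m => m.Prime ∧ Δ ≤ (m : ℝ) ∧ (m : ℝ) < z with hQ
  -- Step 1: only primes `p ∈ [Δ, z)` contribute, and then with the localised indicator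
  have hstep : ∀ m ∈ Finset.Ico 1 ⌈M⌉₊, ∑ n ∈ Finset.Ico 1 ⌈N⌉₊,
      (if m * n ∣ primesProdBelow z then aRowA Δ m * rowInner hD' hε l n * r (m * n) else 0) =
      if Q m then ∑ n ∈ Finset.Ico 1 ⌈N⌉₊,
        (if n ∣ primesProdBelow D' then rowInner hD' hε l n * r (m * n) else 0) else 0 := by
    intro m _
    by_cases hpr : m.Prime ∧ Δ ≤ (m : ℝ)
    · have ha : aRowA Δ m = 1 := by rw [aRowA, if_pos hpr]
      simp only [ha, one_mul]
      by_cases hmz : (m : ℝ) < z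
      · rw [if_pos ⟨hpr.1, hpr.2, hmz⟩]
        refine Finset.sum_congr rfl fun n hn => ?_
        have hn0 : n ≠ 0 := by have := (Finset.mem_Ico.mp hn).1; omega
        rw [ite_mul_rowInner_eq hD' hε hε3 hΔ hz hpr.1 hpr.2 l hn0]
        simp only [hmz, true_and]
      · rw [if_neg (fun h => hmz h.2.2)]
        refine Finset.sum_eq_zero fun n hn => ?_
        have hn0 : n ≠ 0 := by have := (Finset.mem_Ico.mp hn).1; omega
        rw [ite_mul_rowInner_eq hD' hε hε3 hΔ hz hpr.1 hpr.2 l hn0]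
        simp [hmz]
    · have ha : aRowA Δ m = 0 := by rw [aRowA, if_neg hpr]
      rw [if_neg (fun h => hpr ⟨h.1, h.2.1⟩)]
      exact Finset.sum_eq_zero fun n _ => by simp [ha]
  rw [Finset.sum_congr rfl hstep, ← Finset.sum_filter]
  -- Step 2: the index sets agree
  have hset : (Finset.Ico 1 ⌈M⌉₊).filter Q = (Nat.primesBelow ⌈z⌉₊).filter (fun p : ℕ => Δ ≤ (p : ℝ)) := by
    ext p
    simp only [Finset.mem_filter, Finset.mem_Ico, Nat.mem_primesBelow, hQ, Nat.lt_ceil]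
    constructor
    · rintro ⟨-, hp, hΔp, hpz⟩; exact ⟨⟨hpz, hp⟩, hΔp⟩
    · rintro ⟨⟨hpz, hp⟩, hΔp⟩
      exact ⟨⟨hp.one_lt.le, by exact_mod_cast hpz.trans_le hzM⟩, hp, hΔp, hpz⟩
  rw [hset]
  -- Step 3: the `n`-range may be cut to `A'`
  refine Finset.sum_congr rfl fun p _ => ?_
  rw [innerForm]
  symm
  refine Finset.sum_subset (fun n hn => ?_) (fun n hn hnA => ?_)
  · rw [Finset.mem_Ico] at hn ⊢; exact ⟨hn.1, lt_of_lt_of_le hn.2 hAN⟩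
  · split_ifs with hdvd
    · have hnsq : Squarefree n := (squarefree_primesProdBelow D').squarefree_of_dvd hdvd
      by_cases h0 : rowInner hD' hε l n = 0
      · rw [h0, zero_mul]
      · exfalso
        have hA : cA hD' hε 1 0 D' l n ≠ 0 := left_ne_zero_of_mul h0
        have hlt := lt_of_cA_one_ne_zero hD' hε hε3 0 hD'.le le_rfl (mul_one D') hnsq hA
        apply hnA
        rw [Finset.mem_Ico] at hn ⊢
        exact ⟨hn.1, Nat.lt_ceil.mpr hlt⟩
    · rfl

/-- **Evaluation of the rows, case `N³ ≤ M`** (`p · m'` in the `m`-slot, `n = 1`): for `D' ≤ Δ`, `D' ≤ z`,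
`z A' ≤ M` and `N > 1`,
`∑_{m<M} ∑_{n<N} [mn ∣ P(z)] aRowB_l(m) [n = 1] r(mn) = ∑_{Δ ≤ p < z} innerForm_l(r(p·))`. [folklore] -/
theorem rows_B_eval (hε3 : ε ≤ 1 / 3) {Δ z M N : ℝ} (hΔ : D' ≤ Δ) (hz : D' ≤ z) (hzA : z * innerA D' ε ≤ M)
    (hN : 1 < N) (l : ℕ) (r : ℕ → ℝ) :
    ∑ m ∈ Finset.Ico 1 ⌈M⌉₊, ∑ n ∈ Finset.Ico 1 ⌈N⌉₊,
        (if m * n ∣ primesProdBelow z then aRowB hD' hε Δ l m * bRowB n * r (m * n) else 0) =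
      ∑ p ∈ (Nat.primesBelow ⌈z⌉₊).filter (fun p : ℕ => Δ ≤ (p : ℝ)), innerForm hD' hε l (fun d => r (p * d)) := by
  classical
  have hD0 : (0:ℝ) < D' := by linarith
  set X := ⌈M⌉₊ with hX
  set T := (Nat.primesBelow ⌈z⌉₊).filter (fun p : ℕ => Δ ≤ (p : ℝ)) with hT
  -- Step 1: `n = 1`
  have h1N : 1 ∈ Finset.Ico 1 ⌈N⌉₊ := by
    rw [Finset.mem_Ico]; exact ⟨le_rfl, Nat.lt_ceil.mpr (by exact_mod_cast hN)⟩
  have hstep1 : ∀ m ∈ Finset.Ico 1 X, ∑ n ∈ Finset.Ico 1 ⌈N⌉₊,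
      (if m * n ∣ primesProdBelow z then aRowB hD' hε Δ l m * bRowB n * r (m * n) else 0) =
      ∑ p ∈ m.primeFactors.filter (fun p : ℕ => Δ ≤ (p : ℝ)),
        (if m ∣ primesProdBelow z then rowInner hD' hε l (m / p) * r m else 0) := by
    intro m _
    rw [Finset.sum_eq_single_of_mem 1 h1N]
    · simp only [mul_one, bRowB, if_true]
      split_ifs
      · rw [aRowB, Finset.sum_mul]
      · simp
    · intro n _ hn1
      simp [bRowB, hn1]
  rw [Finset.sum_congr rfl hstep1, Finset.sum_sigma' (Finset.Ico 1 X)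
    (fun m => m.primeFactors.filter (fun p : ℕ => Δ ≤ (p : ℝ)))
    (fun m p => if m ∣ primesProdBelow z then rowInner hD' hε l (m / p) * r m else 0)]
  simp only [innerForm]
  rw [Finset.sum_sigma' T (fun _ => Finset.Ico 1 ⌈innerA D' ε⌉₊)
    (fun p d => if d ∣ primesProdBelow D' then rowInner hD' hε l d * r (p * d) else 0)]
  -- Step 2: the bijection `(m, p) ↦ (p, m/p)` between the non-zero terms
  refine Finset.sum_bij_ne_zero (fun x _ _ => ⟨x.2, x.1 / x.2⟩) ?_ ?_ ?_ ?_
  · -- lands in the target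
    rintro ⟨m, p⟩ hx hne
    simp only [Finset.mem_sigma] at hx ⊢
    obtain ⟨hm, hp⟩ := hx
    rw [Finset.mem_filter] at hp
    have hpp : p.Prime := Nat.prime_of_mem_primeFactors hp.1
    have hdvd : m ∣ primesProdBelow z := by by_contra h; exact hne (by rw [if_neg h])
    rw [if_pos hdvd] at hne
    have hrow : rowInner hD' hε l (m / p) ≠ 0 := left_ne_zero_of_mul hne
    have hmsq : Squarefree m := (squarefree_primesProdBelow z).squarefree_of_dvd hdvd
    have hpm : p ∣ m := Nat.dvd_of_mem_primeFactors hp.1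
    have hqsq : Squarefree (m / p) := hmsq.squarefree_of_dvd (Nat.div_dvd_of_dvd hpm)
    have hm1 : 1 ≤ m := (Finset.mem_Ico.mp hm).1
    refine ⟨?_, ?_⟩
    · rw [hT, Finset.mem_filter, Nat.mem_primesBelow]
      refine ⟨⟨Nat.lt_ceil.mpr ((dvd_primesProdBelow_iff hpp z).mp (hpm.trans hdvd)), hpp⟩, hp.2⟩
    · rw [Finset.mem_Ico]
      have hlt := lt_of_cA_one_ne_zero hD' hε hε3 0 hD'.le le_rfl (mul_one D') hqsq (left_ne_zero_of_mul hrow)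
      exact ⟨Nat.div_pos (Nat.le_of_dvd hm1 hpm) hpp.pos, Nat.lt_ceil.mpr hlt⟩
  · -- injective
    rintro ⟨m, p⟩ hx hne ⟨m', p'⟩ hx' hne' heq
    simp only [Sigma.mk.injEq, heq_eq_eq] at heq
    obtain ⟨rfl, hq⟩ := heq
    simp only [Finset.mem_sigma, Finset.mem_filter] at hx hx'
    have hpm : p ∣ m := Nat.dvd_of_mem_primeFactors hx.2.1
    have hpm' : p ∣ m' := Nat.dvd_of_mem_primeFactors hx'.2.1
    have : m = m' := by rw [← Nat.mul_div_cancel' hpm, ← Nat.mul_div_cancel' hpm', hq]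
    subst this; rfl
  · -- surjective onto the non-zero terms
    rintro ⟨p, n⟩ hy hne
    simp only [Finset.mem_sigma] at hy
    obtain ⟨hp, hn⟩ := hy
    rw [hT, Finset.mem_filter, Nat.mem_primesBelow] at hp
    obtain ⟨⟨hpz, hpp⟩, hpΔ⟩ := hp
    have hdvd : n ∣ primesProdBelow D' := by by_contra h; exact hne (by rw [if_neg h])
    rw [if_pos hdvd] at hne
    have hrow : rowInner hD' hε l n ≠ 0 := left_ne_zero_of_mul hne
    have hnsq : Squarefree n := (squarefree_primesProdBelow D').squarefree_of_dvd hdvd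
    have hn1 : 1 ≤ n := (Finset.mem_Ico.mp hn).1
    have hn0 : n ≠ 0 := by omega
    have hnA : (n : ℝ) < innerA D' ε :=
      lt_of_cA_one_ne_zero hD' hε hε3 0 hD'.le le_rfl (mul_one D') hnsq (left_ne_zero_of_mul hrow)
    have hpz' : (p : ℝ) < z := Nat.lt_ceil.mp hpz
    have hpnM : p * n < X := by
      refine Nat.lt_ceil.mpr ?_
      push_cast
      calc (p : ℝ) * n < z * innerA D' ε := mul_lt_mul'' hpz' hnA (Nat.cast_nonneg p) (Nat.cast_nonneg n)
        _ ≤ M := hzA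
    have hpn0 : p * n ≠ 0 := mul_ne_zero hpp.ne_zero hn0
    have hloc : p * n ∣ primesProdBelow z := by
      have hn' : n ∣ primesProdBelow z :=
        BetaSieve.dvd_primesProdBelow_of_primeFactors_lt hnsq fun q hq' =>
          (primeFactors_lt_of_rowInner_ne_zero hD' hε hε3 hrow q hq').trans_le hz
      have hpz'' : p ∣ primesProdBelow z := (dvd_primesProdBelow_iff hpp z).mpr hpz'
      have hpn : Nat.Coprime p n := by
        rw [Nat.Prime.coprime_iff_not_dvd hpp]
        intro hpn
        have := primeFactors_lt_of_rowInner_ne_zero hD' hε hε3 hrow p (Nat.mem_primeFactors.mpr ⟨hpp, hpn, hn0⟩)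
        linarith [hΔ.trans hpΔ]
      exact hpn.mul_dvd_of_dvd_of_dvd hpz'' hn'
    refine ⟨⟨p * n, p⟩, ?_, ?_, ?_⟩
    · simp only [Finset.mem_sigma, Finset.mem_Ico, Finset.mem_filter]
      exact ⟨⟨Nat.one_le_iff_ne_zero.mpr hpn0, hpnM⟩,
        Nat.mem_primeFactors.mpr ⟨hpp, dvd_mul_right p n, hpn0⟩, hpΔ⟩
    · dsimp only
      rw [if_pos hloc, Nat.mul_div_cancel_left n hpp.pos]
      exact hne
    · simp only [Nat.mul_div_cancel_left n hpp.pos]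
  · -- values agree
    rintro ⟨m, p⟩ hx hne
    simp only [Finset.mem_sigma] at hx
    obtain ⟨hm, hp⟩ := hx
    rw [Finset.mem_filter] at hp
    have hpp : p.Prime := Nat.prime_of_mem_primeFactors hp.1
    dsimp only at hne ⊢
    have hdvd : m ∣ primesProdBelow z := by by_contra h; exact hne (by rw [if_neg h])
    rw [if_pos hdvd] at hne ⊢
    have hrow : rowInner hD' hε l (m / p) ≠ 0 := left_ne_zero_of_mul hne
    have hmsq : Squarefree m := (squarefree_primesProdBelow z).squarefree_of_dvd hdvd
    have hpm : p ∣ m := Nat.dvd_of_mem_primeFactors hp.1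
    have hqsq : Squarefree (m / p) := hmsq.squarefree_of_dvd (Nat.div_dvd_of_dvd hpm)
    have hq := primeFactors_lt_of_rowInner_ne_zero hD' hε hε3 hrow
    have hdvd' : m / p ∣ primesProdBelow D' := BetaSieve.dvd_primesProdBelow_of_primeFactors_lt hqsq hq
    rw [if_pos hdvd', Nat.mul_div_cancel' hpm]

end Inner

end Core

end Iwaniec1980b

end Literature.NumberTheory.Sieve

end
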